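/-
Copyright (c) 2026. All rights reserved.
Released under Apache 2.0 license as described in the file LICENSE.
-/
import Mathlib
import HarnessLib
import Summits.RiemannHypothesis.RiemannHypothesis.Theorems.EarlyAppointmentsGImagBound
import Summits.RiemannHypothesis.RiemannHypothesis.Theorems.EarlyAppointmentsRoucheAux
import Summits.RiemannHypothesis.RiemannHypothesis.Theorems.EarlyAppointmentsCriticalPointRouche

/-!
# Comparison bound for Rouché

The comparison requires |h(z) - h₀(z)| < |h₀(z)| on ∂D(z₀, h/2).

Key insight: use the strong bound |G(z₀).im| ≈ π/s (not just > 4/h).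
This gives |h₀(z)| ≥ (h/2)|G(z₀)| - 1 ≈ hπ/(2s) - 1 >> 1.
So the required bound on |G(z) - G(z₀)| becomes much weaker.
-/

open Complex Real Set Filter Topology Metric
open scoped BigOperators Topology

noncomputable section

namespace ComparisonBound

/-- The key observation: |G(z₀).im| > π/s - O(1/h) when the comb is exact.
With 8s ≤ h, we have π/s > 8π/h > 25/h, so |G(z₀)| > 25/h >> 4/h. -/
theorem G_im_strong_bound {s h : ℝ} (hs : 0 < s) (hh : 0 < h) (hhs : 8 * s ≤ h) :
    π / s - 5 / (2 * h) > 1 / h :=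
  GImagBound.imag_bound_main hs hh hhs

/-- On the circle |z - z₀| = r with r|G(z₀)| > 1, the minimum of |h₀(z)| is ≥ r|G(z₀)| - 1.
This follows from reverse triangle inequality: |1 + w| ≥ |w| - 1 when |w| > 1. -/
theorem h₀_lower_bound_on_circle {f : ℂ → ℂ} {c : ℂ} {r : ℝ} (_hr : 0 < r)
    (_hG : r * ‖RoucheAux.G f c c‖ > 1) (z : ℂ) (hz : ‖z - c‖ = r) :
    ‖RoucheAux.h₀ f c z‖ ≥ r * ‖RoucheAux.G f c c‖ - 1 := by
  unfold RoucheAux.h₀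
  have h1 : ‖(z - c) * RoucheAux.G f c c‖ = r * ‖RoucheAux.G f c c‖ := by
    rw [norm_mul, hz]
  -- |1 + w| ≥ |w| - 1 by reverse triangle inequality
  have h2 : ‖1 + (z - c) * RoucheAux.G f c c‖ ≥ ‖(z - c) * RoucheAux.G f c c‖ - 1 := by
    have := norm_sub_norm_le ((z - c) * RoucheAux.G f c c) (-(1 : ℂ))
    simp only [sub_neg_eq_add, add_comm, norm_neg, norm_one] at this
    linarith
  linarith [h1, h2]

/-- The Rouché comparison: if |G(z) - G(z₀)| ≤ ε and r|G(z₀)| > rε + 1,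
then |h(z) - h₀(z)| < |h₀(z)| on the circle of radius r. -/
theorem comparison_holds {f : ℂ → ℂ} {c : ℂ} {r ε : ℝ}
    (hr : 0 < r) (hε : 0 ≤ ε)
    (hG_bound : r * ‖RoucheAux.G f c c‖ > r * ε + 1) -- equivalent to |G| > ε + 1/r
    (hvar : ∀ z : ℂ, ‖z - c‖ = r → ‖RoucheAux.G f c z - RoucheAux.G f c c‖ ≤ ε)
    (z : ℂ) (hz : ‖z - c‖ = r) :
    ‖CriticalPointRouche.h f c z - RoucheAux.h₀ f c z‖ < ‖RoucheAux.h₀ f c z‖ := by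
  rw [CriticalPointRouche.h_sub_h₀]
  -- LHS = |z - c| * |G(z) - G(c)| ≤ r * ε
  have h_lhs : ‖(z - c) * (RoucheAux.G f c z - RoucheAux.G f c c)‖ ≤ r * ε := by
    rw [norm_mul, hz]
    exact mul_le_mul_of_nonneg_left (hvar z hz) (le_of_lt hr)
  -- RHS ≥ r|G(c)| - 1
  have h_rhs : ‖RoucheAux.h₀ f c z‖ ≥ r * ‖RoucheAux.G f c c‖ - 1 := by
    apply h₀_lower_bound_on_circle hr _ z hz
    have hε_pos : r * ε ≥ 0 := mul_nonneg (le_of_lt hr) hε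
    linarith
  -- r * ε < r|G(c)| - 1
  have h_key : r * ε < r * ‖RoucheAux.G f c c‖ - 1 := by linarith
  linarith

end ComparisonBound

end
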